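import Summits.HubbardSuperconductivity.HubbardSuperconductivity.Theses.ColourTheSpin

/-!
# Crux `SgAnchorOrder` (stmt-HubbardSuperconductivity-16273, route `ColourTheSpin`, rank 3) —
# NEGATION SKELETON (registrar report: no honest positive `Lines/birth.lean` exists)

`SgAnchorOrder` asks for ONE constant `c > 0` such that for ALL gauge couplings `g ≥ g₀` (unbounded
above) and all even `L ≥ L₀` every ground state `ψ` of the `N_L`-block of the Q8-spin-gauged torus
`H_g(L,U)` has gauged B1g pair order `c·L⁴·‖ψ‖² ≤ ⟨ψ, Δ_d^g† Δ_d^g ψ⟩`.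

STRONG-COUPLING FREEZING kills the `g`-uniformity (refuter-rreview-0816T18-1-0, evidence
`EVIDENCE-ColourTheSpin-SgAnchorOrder.md` v1–v3 on the item, 2026-08-16; re-derived independently by
this registrar, NOTES.md §Refutation):
* the electric operator `E_b` (inlined: `δ_(k,k') − 1/8` on link configurations agreeing off `b`) is
  `1 − Q_b`, `Q_b` = average over the value of link `b`; its kernel is the functions CONSTANT in `k_b`,
  so the joint kernel of `Σ_b E_b` (the electric vacuum `Π₀`) is `(fermions) ⊗ (constant link function)`;
* for a ground state `ψ` of the block, `g² ⟨ψ, Σ_b E_b ψ⟩ ≤ (‖hop + hop†‖ + E_trial) ‖ψ‖²` with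
  `‖hop + hop†‖ ≤ 16 L²` and `E_trial ≤ U·N_L + 2L²/g²` (any `N_L`-configuration ⊗ constant links:
  the hopping has zero expectation there because `Σ_(u ∈ Q8) ρ(u) = 0`), and `Σ_b E_b ≥ 1 − Π₀`
  (commuting projectors); hence `‖(1 − Π₀) ψ‖² ≤ η(g) ‖ψ‖²`, `η(g) = O_(L,U)(g⁻²)`;
* the gauged pair field `P = Σ_b ± Σ_(στ) c_(xσ) c_(x+e_i,τ) ⊗ diag_k (ε ρ(k_b))_(στ)` MULTIPLIES link
  `b` by a function of zero `Q8`-average (`Σ_u (ερ(u))_(στ) = 0`, kernel-checked by the refuter: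
  `CTS_SchurFacts.lean`, `sum_rQ`), so `P_b Π₀ ψ` carries electric flux on `b` and
  `⟨P_b Π₀ψ, P_(b') Π₀ψ⟩ = 0` for `b ≠ b'`: `‖P Π₀ ψ‖² = Σ_b ‖P_b Π₀ ψ‖² ≤ 16·|Bond L|·‖ψ‖² = 32 L² ‖ψ‖²`;
* so `⟨ψ, P†P ψ⟩ ≤ (√32·L + 8L²·√η(g))² ‖ψ‖² ≤ 33·L²·‖ψ‖²` once `g ≥ G(L,U)`
  (refuter's explicit threshold: `g ≥ max(1, 91 L⁴ √(U+18))` gives `≤ (32L² + 1)‖ψ‖²`);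
* given the crux's `(U, δ, g₀, c, L₀)`, take an even `L ≥ L₀` with `c·L² > 33` and then
  `g = max(g₀, G(L,U))`: a normalised ground state exists (finite Hermitian block on a non-empty
  index type, `N_L ≤ L² < 2L²`), and `c L⁴ ≤ ⟨P†P⟩ ≤ 33 L²` is absurd.

Consequently every skeleton `stubs → SgAnchorOrder` must contain a stub contradicting attached
refutation evidence (costume); none is registered. THIS FILE hands the disprover the checked
reduction of `¬ SgAnchorOrder` to two TRUE finite-dimensional lemmas:

* `stub_pairCeiling : PairCeiling` — the `O(L²)` CEILING (no off-diagonal LRO of the transported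
  pair field at the frozen end): `∃ A, ∀ U > 0, δ ∈ (0,½), L, ∃ G, ∀ g ≥ G`, every ground state of the
  block has `⟨ψ, (P†P)_B ψ⟩.re ≤ A·L²·(ψ†ψ).re` (witness `A = 33`, `G = max(1, 91 L⁴ √(U+18))`). M–L.
* `stub_groundStateExists : GroundStateExists` — for all `U, g`, `δ ∈ (0,½)`, `L ≥ 1` the block has a
  NORMALISED ground state in the crux's own sense (`ψ†ψ = 1`, `ψ ≠ 0`, eigenvector at an eigenvalue
  below every Rayleigh quotient): the inlined `H` is Hermitian (hop + hopᴴ; real diagonal `U`,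
  electric = real symmetric, magnetic = real diagonal since `tr ρ(u) ∈ {2, 0, −2}`), the block index
  type is non-empty (`N_L = 2⌊(1−δ)L²/2⌋ ≤ 2L²` orbitals), spectral theorem. S–M.
* `not_SgAnchorOrder_of_stubs` — SORRY-FREE composition (Archimedean choice of `L`, `g := max g₀ G`,
  one `le_trans` through the crux's own inlined `let` block, three lines of arithmetic).

The let-blocks below are the crux's, VERBATIM (same binder names `U δ g L`), so that after
zeta-reduction the block Hamiltonian `H.toBlock p p`, the pair form `(Pᴴ * P).toBlock p p` and the
ground-state predicate are syntactically the crux's.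
-/

noncomputable section

set_option linter.dupNamespace false
set_option linter.unusedVariables false

namespace Summit.HubbardSuperconductivity.HubbardSuperconductivity.Cruxes.SgAnchorOrder.Negation

open scoped BigOperators Topology Manifold Classical MeasureTheory ProbabilityTheory Matrix InnerProductSpace ComplexConjugate ContinuousMap
open Filter Set Function TopologicalSpace MeasureTheory
open Literature.Hubbard
open Summit.HubbardSuperconductivity.HubbardSuperconductivity.Theses.ColourTheSpin

/-! ## The two negative stubs (both believed TRUE; `sorry` only here) -/

/-- STUB STATEMENT 1 — `O(L²)` PAIR CEILING AT THE FROZEN END. There is an absolute `A` (witness 33)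
such that for every `U > 0`, `δ ∈ (0,½)` and side `L ≥ 1` there is a coupling threshold `G = G(L,U)`
beyond which EVERY ground state `ψ` of the `N_L`-block of the inlined Q8-spin-gauged torus `H_g(L,U)`
has `⟨ψ, (Δ_d^g† Δ_d^g)_B ψ⟩.re ≤ A·L²·(ψ†ψ).re`: electric-vacuum concentration
`‖(1−Π₀)ψ‖² = O_(L,U)(g⁻²)‖ψ‖²` plus flux-orthogonality of the transported bond pair field
(`Σ_u (ερ(u))_(στ) = 0` ⇒ cross terms `b ≠ b'` vanish on `Π₀ψ`). [refuter-rreview-0816T18-1-0,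
EVIDENCE-ColourTheSpin-SgAnchorOrder.md v3 §3; CTS_SchurFacts.lean; doi:10.1103/physrevd.11.395] -/
def PairCeiling : Prop :=
  open Literature.MathematicalPhysics.QuantumLattice in ∃ A : ℝ, ∀ U : ℝ, 0 < U → ∀ δ ∈ Set.Ioo (0 : ℝ) (1 / 2), ∀ (L : ℕ) [NeZero L], ∃ G : ℝ, ∀ g : ℝ, G ≤ g → (let m : Fin 2 × ZMod 4 → Fin 2 × ZMod 4 → Fin 2 × ZMod 4 := fun u v => (u.1 + v.1, if u.1 = 0 then (if v.1 = 0 then u.2 + v.2 else v.2 - u.2) else if v.1 = 0 then u.2 + v.2 else 2 + v.2 - u.2); let iv : Fin 2 × ZMod 4 → Fin 2 × ZMod 4 := fun u => (u.1, if u.1 = 0 then -u.2 else u.2 + 2); let r : Fin 2 × ZMod 4 → Fin 2 → Fin 2 → ℂ := fun u σ τ => if u.1 = 0 then (if σ = τ then (if σ = 0 then Complex.I else -Complex.I) ^ u.2.val else 0) else if σ = τ then 0 else if σ = 0 then -(-Complex.I) ^ u.2.val else Complex.I ^ u.2.val; let hop := ∑ b : GaugedHubbard.Bond L, ∑ σ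 : Fin 2, ∑ τ : Fin 2, Matrix.kroneckerMap (· * ·) (creation (orb b.1 σ) * annihilation (orb (b.1.shift b.2) τ)) (Matrix.diagonal fun k : GaugedHubbard.Bond L → Fin 2 × ZMod 4 => r (k b) σ τ); let H := -(hop + hopᴴ) + ((U : ℝ) : ℂ) • Matrix.kroneckerMap (· * ·) (∑ x : FermionTorus 2 L, numberOp x 0 * numberOp x 1) (1 : Matrix (GaugedHubbard.Bond L → Fin 2 × ZMod 4) (GaugedHubbard.Bond L → Fin 2 × ZMod 4) ℂ) + ((g ^ 2 : ℝ) : ℂ) • Matrix.kroneckerMap (· * ·) (1 : Matrix (Finset (Orb (FermionTorus 2 L))) _ ℂ) (∑ b : GaugedHubbard.Bond L, Matrix.of fun k k' : GaugedHubbard.Bond L → Fin 2 × ZMod 4 => if k' = Function.update k b (k' b) then (if k b = k' b then (1 : ℂ) else 0) - 1 / 8 else 0) + ((1 / g ^ 2 : ℝ) : ℂ) • Matrix.kroneckerMap (· * ·) (1 : Matrix (Finset (Orb (FermionTorus 2 L))) _ ℂ) (Matrix.diagonal fun k : GaugedHubbard.Bond L → Fin 2 × ZMod 4 => ∑ x :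 FermionTorus 2 L, (1 - (r (m (m (m (k (x, 0)) (k (x.shift 0, 1))) (iv (k (x.shift 1, 0)))) (iv (k (x, 1)))) 0 0 + r (m (m (m (k (x, 0)) (k (x.shift 0, 1))) (iv (k (x.shift 1, 0)))) (iv (k (x, 1)))) 1 1) / 2)); let P := ∑ b : GaugedHubbard.Bond L, (if b.2 = 0 then (1 : ℂ) else -1) • ∑ σ : Fin 2, ∑ τ : Fin 2, Matrix.kroneckerMap (· * ·) (annihilation (orb b.1 σ) * annihilation (orb (b.1.shift b.2) τ)) (Matrix.diagonal fun k : GaugedHubbard.Bond L → Fin 2 × ZMod 4 => if σ = 0 then r (k b) 1 τ else -r (k b) 0 τ); let p := fun ik : Finset (Orb (FermionTorus 2 L)) × (GaugedHubbard.Bond L → Fin 2 × ZMod 4) => ik.1.card = 2 * ⌊(1 - δ) * (L : ℝ) ^ 2 / 2⌋₊; ∀ ψ : {ik // p ik} → ℂ, (ψ ≠ 0 ∧ ∃ E : ℝ, H.toBlock p p *ᵥ ψ = (E : ℂ) • ψ ∧ ∀ φ : {ik // p ik} → ℂ, E * (star φ ⬝ᵥ φ).re ≤ (star φ ⬝ᵥ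 H.toBlock p p *ᵥ φ).re) → (star ψ ⬝ᵥ (Pᴴ * P).toBlock p p *ᵥ ψ).re ≤ A * (L : ℝ) ^ 2 * (star ψ ⬝ᵥ ψ).re)

/-- STUB STATEMENT 2 — A NORMALISED GROUND STATE OF THE BLOCK EXISTS, in the crux's own sense, for all
`U, g : ℝ`, `δ ∈ (0,½)`, `L ≥ 1`: the inlined `H` is Hermitian, the `N_L`-block index type is non-empty
(`N_L ≤ 2L²`), and the bottom eigenvector of a Hermitian matrix minimises the Rayleigh quotient.
[Matrix.IsHermitian.eigenvalues (Mathlib); folklore] -/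
def GroundStateExists : Prop :=
  open Literature.MathematicalPhysics.QuantumLattice in ∀ (U δ g : ℝ) (L : ℕ) [NeZero L], δ ∈ Set.Ioo (0 : ℝ) (1 / 2) → (let m : Fin 2 × ZMod 4 → Fin 2 × ZMod 4 → Fin 2 × ZMod 4 := fun u v => (u.1 + v.1, if u.1 = 0 then (if v.1 = 0 then u.2 + v.2 else v.2 - u.2) else if v.1 = 0 then u.2 + v.2 else 2 + v.2 - u.2); let iv : Fin 2 × ZMod 4 → Fin 2 × ZMod 4 := fun u => (u.1, if u.1 = 0 then -u.2 else u.2 + 2); let r : Fin 2 × ZMod 4 → Fin 2 → Fin 2 → ℂ := fun u σ τ => if u.1 = 0 then (if σ = τ then (if σ = 0 then Complex.I else -Complex.I) ^ u.2.val else 0) else if σ = τ then 0 else if σ = 0 then -(-Complex.I) ^ u.2.val else Complex.I ^ u.2.val; let hop := ∑ b : GaugedHubbard.Bond L, ∑ σ : Fin 2, ∑ τ : Fin 2, Matrix.kroneckerMap (· * ·) (creation (orb b.1 σ) * annihilation (orb (b.1.shift b.2) τ)) (Matrix.diagonal fun k : GaugedHubbard.Bond L → Fin 2 × ZMod 4 =>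 r (k b) σ τ); let H := -(hop + hopᴴ) + ((U : ℝ) : ℂ) • Matrix.kroneckerMap (· * ·) (∑ x : FermionTorus 2 L, numberOp x 0 * numberOp x 1) (1 : Matrix (GaugedHubbard.Bond L → Fin 2 × ZMod 4) (GaugedHubbard.Bond L → Fin 2 × ZMod 4) ℂ) + ((g ^ 2 : ℝ) : ℂ) • Matrix.kroneckerMap (· * ·) (1 : Matrix (Finset (Orb (FermionTorus 2 L))) _ ℂ) (∑ b : GaugedHubbard.Bond L, Matrix.of fun k k' : GaugedHubbard.Bond L → Fin 2 × ZMod 4 => if k' = Function.update k b (k' b) then (if k b = k' b then (1 : ℂ) else 0) - 1 / 8 else 0) + ((1 / g ^ 2 : ℝ) : ℂ) • Matrix.kroneckerMap (· * ·) (1 : Matrix (Finset (Orb (FermionTorus 2 L))) _ ℂ) (Matrix.diagonal fun k : GaugedHubbard.Bond L → Fin 2 × ZMod 4 => ∑ x : FermionTorus 2 L, (1 - (r (m (m (m (k (x, 0)) (k (x.shift 0, 1))) (iv (k (x.shift 1, 0)))) (iv (k (x, 1)))) 0 0 + r (m (m (m (k (x, 0)) (k (x.shift 0, 1))) (iv (k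 (x.shift 1, 0)))) (iv (k (x, 1)))) 1 1) / 2)); let p := fun ik : Finset (Orb (FermionTorus 2 L)) × (GaugedHubbard.Bond L → Fin 2 × ZMod 4) => ik.1.card = 2 * ⌊(1 - δ) * (L : ℝ) ^ 2 / 2⌋₊; ∃ ψ : {ik // p ik} → ℂ, star ψ ⬝ᵥ ψ = 1 ∧ (ψ ≠ 0 ∧ ∃ E : ℝ, H.toBlock p p *ᵥ ψ = (E : ℂ) • ψ ∧ ∀ φ : {ik // p ik} → ℂ, E * (star φ ⬝ᵥ φ).re ≤ (star φ ⬝ᵥ H.toBlock p p *ᵥ φ).re))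

theorem stub_pairCeiling : PairCeiling := by
  sorry

theorem stub_groundStateExists : GroundStateExists := by
  sorry

/-! ## Composition (sorry-free) -/

/-- `PairCeiling → GroundStateExists → ¬ SgAnchorOrder`: take `A` from the ceiling and
`(U, δ, g₀, c, L₀)` from the anchor; choose an even `L ≥ L₀` with `A < c·L²` (Archimedes), the
threshold `G(L,U)` and `g := max g₀ G`; a normalised ground state `ψ` exists; the anchor gives
`c·L⁴ ≤ ⟨P†P⟩.re`, the ceiling `⟨P†P⟩.re ≤ A·L²`, and `A·L² < c·L²·L²` — contradiction. -/
theorem not_SgAnchorOrder_of_stubs (hC : PairCeiling) (hE : GroundStateExists) :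
    ¬ SgAnchorOrder := by
  intro hAnchor
  obtain ⟨A, hA⟩ := hC
  obtain ⟨U, hU, δ, hδ, g₀, hg₀, c, hc, L₀, hcrux⟩ := hAnchor
  -- choose the side: even, ≥ L₀, positive, with A < c·L²
  obtain ⟨n, hn⟩ := exists_nat_gt (A / c)
  obtain ⟨L, hL0, hLn, hLeven, hLpos⟩ :
      ∃ L : ℕ, L₀ ≤ L ∧ n < L ∧ Even L ∧ 0 < L :=
    ⟨2 * (n + L₀ + 1), by omega, by omega, ⟨n + L₀ + 1, by ring⟩, by omega⟩
  haveI : NeZero L := ⟨Nat.pos_iff_ne_zero.mp hLpos⟩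
  have hLreal : (1 : ℝ) ≤ (L : ℝ) := by exact_mod_cast hLpos
  have hL2pos : (0 : ℝ) < (L : ℝ) ^ 2 := by positivity
  have hAL : A < c * (L : ℝ) ^ 2 := by
    have h1 : (n : ℝ) < (L : ℝ) := by exact_mod_cast hLn
    have h2 : (L : ℝ) ≤ (L : ℝ) ^ 2 := by nlinarith
    have h3 : A / c < (L : ℝ) ^ 2 := lt_of_lt_of_le (hn.trans h1) h2
    have h4 : A < (L : ℝ) ^ 2 * c := (div_lt_iff₀ hc).mp h3
    linarith [mul_comm ((L : ℝ) ^ 2) c]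
  -- choose the coupling: beyond both thresholds
  obtain ⟨G, hG⟩ := hA U hU δ hδ L
  have hceil := hG (max g₀ G) (le_max_right g₀ G)
  have hcr := hcrux (max g₀ G) (le_max_left g₀ G) L hL0 hLeven
  have hex := hE U δ (max g₀ G) L hδ
  -- a normalised ground state, and the two inequalities through the crux's own let-block
  obtain ⟨ψ, hnorm, hGS⟩ := hex
  have h1 := hcr ψ hGS
  have h2 := hceil ψ hGS
  have hn1 : (star ψ ⬝ᵥ ψ).re = 1 := by rw [hnorm]; simp
  have h3 : c * (L : ℝ) ^ 4 * (star ψ ⬝ᵥ ψ).re ≤ A * (L : ℝ) ^ 2 * (star ψ ⬝ᵥ ψ).re :=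
    le_trans h1 h2
  rw [hn1, mul_one, mul_one] at h3
  clear h1 h2 hceil hcr hGS hnorm
  have h4 : A * (L : ℝ) ^ 2 < c * (L : ℝ) ^ 2 * (L : ℝ) ^ 2 := mul_lt_mul_of_pos_right hAL hL2pos
  have h5 : c * (L : ℝ) ^ 4 = c * (L : ℝ) ^ 2 * (L : ℝ) ^ 2 := by ring
  linarith

/-- THE NEGATION, BY NAME, from the two registered stubs (its only non-whitelisted axiom is the stubs'
`sorryAx`; it becomes a refutation of the crux the moment both stubs are theorems). -/
theorem not_SgAnchorOrder_of : ¬ SgAnchorOrder :=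
  not_SgAnchorOrder_of_stubs stub_pairCeiling stub_groundStateExists

end Summit.HubbardSuperconductivity.HubbardSuperconductivity.Cruxes.SgAnchorOrder.Negation
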